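import Summits.AtomisticToContinuum.HydrodynamicLimit.Theses.LindebergRandomFuture
import Summits.AtomisticToContinuum.HydrodynamicLimit.Theorems.LambertianContactSwapLambertianEulerOfHearts
import Summits.AtomisticToContinuum.HydrodynamicLimit.Theses.LambertianContactSwap
import Summits.AtomisticToContinuum.HydrodynamicLimit.Theorems.LambertianContactSwapLambertianEulerArchimedes
import Summits.AtomisticToContinuum.HydrodynamicLimit.Theorems.LambertianContactSwapLambertianEulerLambertLaw
import Summits.AtomisticToContinuum.HydrodynamicLimit.Theorems.LambertianContactSwapLambertianEulerPovzner
import Summits.AtomisticToContinuum.HydrodynamicLimit.Theorems.LambertianContactSwapLambertianEulerPairPovzner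
import Summits.AtomisticToContinuum.HydrodynamicLimit.Theorems.LambertianContactSwapLambertianEulerContactIsotropy
import Summits.AtomisticToContinuum.HydrodynamicLimit.Theorems.LambertianContactSwapLambertianEulerMomentLedgerChain
import Summits.AtomisticToContinuum.HydrodynamicLimit.Theorems.LambertianContactSwapLambertianEulerGibbsInvariance
import Summits.AtomisticToContinuum.HydrodynamicLimit.Theorems.LambertianContactSwapLambertianEulerEntropyToHydro
import Summits.AtomisticToContinuum.HydrodynamicLimit.Theorems.LambertianContactSwapLambertianEulerWindow
import Summits.AtomisticToContinuum.HydrodynamicLimit.Theorems.LambertianContactSwapLambertianEulerMarkov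
import Summits.AtomisticToContinuum.HydrodynamicLimit.Theorems.LambertianContactSwapLambertianEulerIterate
import Summits.AtomisticToContinuum.HydrodynamicLimit.Theorems.LambertianContactSwapLambertianEulerDock
import Summits.AtomisticToContinuum.HydrodynamicLimit.Theorems.LambertianContactSwapLambertianEulerKlLedger
import Summits.AtomisticToContinuum.HydrodynamicLimit.Theorems.LambertianContactSwapLambertianEulerLawSemigroup
import Summits.AtomisticToContinuum.HydrodynamicLimit.Theorems.LambertianContactSwapLambertianEulerDockRf
import Summits.AtomisticToContinuum.HydrodynamicLimit.Theorems.LambertianContactSwapLambertianEulerLambertDirMean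
import Summits.AtomisticToContinuum.HydrodynamicLimit.Theorems.LambertianContactSwapLambertianEulerPairMeanSq
import Summits.AtomisticToContinuum.HydrodynamicLimit.Theorems.LambertianContactSwapLambertianEulerPathwiseProduction
import Summits.AtomisticToContinuum.HydrodynamicLimit.Theorems.LambertianContactSwapLambertianEulerWindowLedger
import Summits.AtomisticToContinuum.HydrodynamicLimit.Theorems.LambertianContactSwapLambertianEulerCollisionCompensator
import Summits.AtomisticToContinuum.HydrodynamicLimit.Theorems.LambertianContactSwapLambertianEulerCompensatedJump
import Summits.AtomisticToContinuum.HydrodynamicLimit.Theorems.LambertianContactSwapLambertianEulerAprioriEntropyBound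
import Summits.AtomisticToContinuum.HydrodynamicLimit.Theorems.LambertianContactSwapLambertianEulerCollisionIntensity
import Summits.AtomisticToContinuum.HydrodynamicLimit.Theorems.LambertianContactSwapLambertianEulerTwoTimeLaw
import Summits.AtomisticToContinuum.HydrodynamicLimit.Theorems.LambertianContactSwapLambertianEulerCollisionBudget
import Summits.AtomisticToContinuum.HydrodynamicLimit.Theorems.LambertianContactSwapLambertianEulerExpectedWindowProductionTools
import Summits.AtomisticToContinuum.HydrodynamicLimit.Theorems.LambertianContactSwapLambertianEulerExpectedWindowProduction
import Summits.AtomisticToContinuum.HydrodynamicLimit.Theorems.LambertianContactSwapLambertianEulerProductionSplit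
import Summits.AtomisticToContinuum.HydrodynamicLimit.Theorems.TwoClocksClampedEntropyClockTimeZeroReference
import Summits.AtomisticToContinuum.HydrodynamicLimit.Theorems.TwoClocksClampedEntropyClockDiscreteEntropyGronwall
import Summits.AtomisticToContinuum.HydrodynamicLimit.Theorems.TwoClocksClampedEntropyClockKlDivLawAtLocalGibbsNeTop
import Literature.MathematicalPhysics.KineticTheory.LambertianRedrawNondegenerate
import Literature.MathematicalPhysics.KineticTheory.Hilbert6Wave0Proofs
import Literature.MathematicalPhysics.KineticTheory.HardSphereEulerLLN
import Literature.Barriers.AtomisticToContinuum.HighMomentumCutoff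
import Literature.Analysis.FluidPDE.HardSphereAlexander
import HarnessLib

/-! TTRL-lite variant V12899 of stmt-AtomisticToContinuum-11854 -/

namespace Summit.AtomisticToContinuum.HydrodynamicLimit.Theorems

open scoped BigOperators Topology ENNReal InnerProductSpace
open MeasureTheory ProbabilityTheory Filter Set InformationTheory
open Literature.MathematicalPhysics.KineticTheory
open Literature.Analysis.FluidPDE Literature.Analysis.FluidPDE.Alexander
open Summit.AtomisticToContinuum.HydrodynamicLimit.Theses.LambertianContactSwap
open Summit.AtomisticToContinuum.HydrodynamicLimit.Theorems.ClampedCurrentsDockPathwise (gSum DgSum)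

/-- TTRL-lite variant V12899 of `stub_kineticOneBlockInMeanLambda` (stmt-AtomisticToContinuum-11854)
is **false**: the `drop_hyp` probe keeps only the 1-D quantifier kernel
"`∀ ε ∃ C(ε)` ⟹ `∃ C ∀ ε`" for a bound `Y h ≤ C * h + ε` on `[0, 1]`, with nothing tying the
family `C(ε)` together. Witness `Y = Real.sqrt`: for every `ε > 0`, `√h ≤ h / (4ε) + ε`
(since `h / (4ε) + ε - √h = (√h - 2ε)² / (4ε) ≥ 0`), so the hypothesis holds with `C(ε) = 1/(4ε)`;
but a single `C` working for all `ε` forces `√h ≤ C * h` on `[0, 1]`, which fails at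
`h = a²`, `a = 1 / (C + 1)` (there `√h = a` while `C * h = a * (C a) = a * (1 - a) < a`). -/
theorem stub_kineticOneBlockInMeanLambda_var12899_false :
    ¬ (∀ (Y : ℝ → ℝ), (∀ ε : ℝ, 0 < ε → ∃ C : ℝ, 0 ≤ C ∧ ∀ h : ℝ, 0 ≤ h → h ≤ 1 →
      Y h ≤ C * h + ε) → ∃ C : ℝ, 0 ≤ C ∧ ∀ ε : ℝ, 0 < ε → ∀ h : ℝ, 0 ≤ h → h ≤ 1 →
      Y h ≤ C * h + ε) := by
  intro H
  -- The hypothesis holds for `Y = Real.sqrt` with `C(ε) = 1 / (4 ε)`.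
  have hyp : ∀ ε : ℝ, 0 < ε → ∃ C : ℝ, 0 ≤ C ∧ ∀ h : ℝ, 0 ≤ h → h ≤ 1 →
      Real.sqrt h ≤ C * h + ε := by
    intro ε hε
    refine ⟨1 / (4 * ε), by positivity, ?_⟩
    intro h h0 _h1
    set t : ℝ := 1 / (4 * ε) with ht_def
    have ht : 0 ≤ t := by positivity
    have hs : Real.sqrt h ^ 2 = h := Real.sq_sqrt h0
    have e3 : 4 * t * ε = 1 := by
      rw [ht_def]
      field_simp
    have e1 : 0 ≤ t * (Real.sqrt h - 2 * ε) ^ 2 := mul_nonneg ht (sq_nonneg _)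
    have e4 : t * (Real.sqrt h - 2 * ε) ^ 2 = t * h - Real.sqrt h + ε := by
      have : t * (Real.sqrt h - 2 * ε) ^ 2
          = t * Real.sqrt h ^ 2 - (4 * t * ε) * Real.sqrt h + (4 * t * ε) * ε := by ring
      rw [this, hs, e3]
      ring
    linarith
  obtain ⟨C, hC, hb⟩ := H Real.sqrt hyp
  -- A uniform `C` forces `√h ≤ C * h` on `[0, 1]`.
  have key : ∀ h : ℝ, 0 ≤ h → h ≤ 1 → Real.sqrt h ≤ C * h := by
    intro h h0 h1
    apply le_of_forall_pos_le_add
    intro ε hε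
    exact hb ε hε h h0 h1
  have hC1 : 0 < C + 1 := by linarith
  set a : ℝ := 1 / (C + 1) with ha_def
  have ha : 0 < a := by positivity
  have haC1 : a * (C + 1) = 1 := by
    rw [ha_def]
    field_simp
  have ha1 : a ^ 2 ≤ 1 := by nlinarith [mul_nonneg ha.le hC]
  have hkey := key (a ^ 2) (by positivity) ha1
  rw [Real.sqrt_sq ha.le] at hkey
  -- `hkey : a ≤ C * a ^ 2`, but `C * a ^ 2 = a - a ^ 2 < a`.
  have e : C * a ^ 2 = a - a ^ 2 := by linear_combination a * haC1
  nlinarith [mul_pos ha ha]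

end Summit.AtomisticToContinuum.HydrodynamicLimit.Theorems
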